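import Summits.AnomalousDissipation.AnomalousDissipation.Theorems.SawtoothPulseCascadeK1LocalisedCascadeCornerTraceGeomSum
import Summits.AnomalousDissipation.AnomalousDissipation.Theorems.SawtoothPulseCascadeK1LocalisedCascadeCornerTraceSumNeg

/-!
# K1loc — helper: THE ALL-ORDERS CORNER-TRACE BOUND FOR THE NEGATIVE LOBE («CT-GEO» 2b/4)

Helper file of the prover lane on the crux `K1LocalisedCascade` (stmt-AnomalousDissipation-19491), route
`SawtoothPulseCascade` (S-D fibre ledger, corner-trace track; finding F-p1g9-1, memo v15).
`…CornerTraceGeomSum.cornerTraceGeom_sum_sq_le` is stated for the POSITIVE lobe `λ = L₂` (fibres `n > 0`).  For `λ = −L₂`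
the chirp coefficients reflect (`…CornerTraceSumNeg.fourierCoeff_nTooth_exactChirp_neg`), so reindexing `k ↦ −k`, `l ↦ −l`
(the weights `Φ_Λ(k)Φ_i(k)`, `ξ_p(k)²`, `|l|^{2p}` are even, the residue classes reflect `ρ ↦ −ρ`) gives
**`cornerTraceGeom_sum_sq_le_neg`**: the same bound with the corner traces of `T_i = Σ_l c_l l^i e_l` at the REFLECTED corners
`−(4r∓1)/(4N)` (`T′_i(y) = (−1)^i T_i(−y)` has the same norms).  No definitions; nothing about the crux.
[cite: Grafakos2014, Prop. 3.1.2 (5), §3.1.3] [problem: turb]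
-/

-- `Summit.<Summit>.<Problem>`: single-conjunct summit, the duplicate namespace segment is deliberate.
set_option linter.dupNamespace false

noncomputable section

namespace Summit.AnomalousDissipation.AnomalousDissipation.Theorems.SawtoothPulseCascade.K1Window

open MeasureTheory Set Filter Topology Function Complex AddCircle
open scoped Real
open Literature.Analysis Literature.Analysis.FunctionSpaces Literature.Analysis.FunctionSpaces.Torus Literature.Analysis.FluidPDE
open Literature.Analysis.FluidPDE.SawtoothCascade
open Summit.AnomalousDissipation.AnomalousDissipation.Theorems.SawtoothPulseCascade.K1Start

set_option maxHeartbeats 800000 in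
/-- **THE ALL-ORDERS CORNER-TRACE BOUND, NEGATIVE LOBE**: the statement of `cornerTraceGeom_sum_sq_le` for the exact `N`-tooth
chirp with lobe `−L₂`, with the corner traces taken at the reflected corners `−(4r∓1)/(4N)`; the scalar hypotheses are the same
(for all residue classes `ρ`). [cite: Grafakos2014, Prop. 3.1.2 (5), §3.1.3] -/
theorem cornerTraceGeom_sum_sq_le_neg {N : ℕ} (hN : 0 < N) {L₂ : ℕ} {g₀ : UnitAddCircle → ℂ}
    (hg₀ : ∀ t : ℝ, g₀ (t : UnitAddCircle) =
      Complex.exp (-(2 * π * I * ((-(L₂ : ℤ) : ℤ) : ℂ) * ((tri (2 * π * N * t) / (2 * π * N) : ℝ) : ℂ))))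
    (c : ℤ → ℂ) (S : Finset ℤ) {L D : ℕ} (hD : 0 < D) (hS : ∀ l ∈ S, |l| ≤ L)
    (W : Finset ℤ) (hW : ∀ k ∈ W, |k| + L + D ≤ (L₂ : ℤ)) (p : ℕ) {Λ ε : ℝ} (hΛ : 0 < Λ) (hε : 0 < ε)
    {τ : ℕ → ℝ} {σξ Mp : ℝ}
    (hτ : ∀ i ∈ Finset.range p, ∀ ρ : ℤ,
      ∑ k ∈ W.filter (fun k => (N : ℤ) ∣ k - ρ),
        (∑ i' ∈ Finset.range p, Λ ^ i' * (1 / ((L₂ : ℝ) + k) ^ (i' + 1) + 1 / ((L₂ : ℝ) - k) ^ (i' + 1))) *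
          (1 / ((L₂ : ℝ) + k) ^ (i + 1) + 1 / ((L₂ : ℝ) - k) ^ (i + 1)) * Λ ^ i ≤ τ i)
    (hσ : ∀ ρ : ℤ, ∑ k ∈ W.filter (fun k => (N : ℤ) ∣ k - ρ),
      ((1 / ((L₂ : ℝ) + k) ^ p + 1 / ((L₂ : ℝ) - k) ^ p) / D) ^ 2 ≤ σξ)
    (hMp : ∀ k : ℤ, ∑ l ∈ S.filter (fun l => (N : ℤ) ∣ k - l), |(l : ℝ)| ^ (2 * p) ≤ Mp) :
    ∑ k ∈ W, ‖∑ l ∈ S, c l * fourierCoeff g₀ (k - l)‖ ^ 2 ≤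
      (1 + ε) * ((N : ℝ) / (2 * π ^ 2)) * ∑ i ∈ Finset.range p, τ i / Λ ^ (2 * i) *
          (∑ r ∈ Finset.range N, ‖∑ l ∈ S, c l * (l : ℂ) ^ i *
              Complex.exp (2 * π * I * l * (-((4 * (r : ℝ) - 1) / (4 * N))))‖ ^ 2 +
            ∑ r ∈ Finset.range N, ‖∑ l ∈ S, c l * (l : ℂ) ^ i *
              Complex.exp (2 * π * I * l * (-((4 * (r : ℝ) + 1) / (4 * N))))‖ ^ 2) +
        (1 + ε⁻¹) * ((N : ℝ) ^ 2 / π ^ 2) * σξ * Mp * ∑ l ∈ S, ‖c l‖ ^ 2 := by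
  classical
  -- the positive-lobe chirp
  obtain ⟨hg'c, hg'⟩ := continuous_exactChirp_lift N (L₂ : ℤ)
  set g' := (periodic_exactChirpFun N (L₂ : ℤ)).lift with hg'def
  -- reflect the coefficients
  have hcoef : ∀ k ∈ W, ∀ l ∈ S, fourierCoeff g₀ (k - l) = fourierCoeff g' ((-k) - (-l)) := by
    intro k hk l hl
    have h1 := hW k hk; have h2 := hS l hl
    have hk' := le_abs_self k; have hk'' := neg_abs_le k; have hl' := le_abs_self l; have hl'' := neg_abs_le l
    rw [show (-k) - (-l) = -(k - l) by ring]
    exact fourierCoeff_nTooth_exactChirp_neg hN (L₂ : ℤ) hg₀ hg' (by omega) (by omega)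
  -- reindex `l ↦ −l`, `k ↦ −k`
  set c' : ℤ → ℂ := fun l => c (-l) with hc'
  set S' : Finset ℤ := S.image (fun l => -l) with hS'
  set W' : Finset ℤ := W.image (fun k => -k) with hW'
  have hinjS : Set.InjOn (fun l : ℤ => -l) S := fun a _ b _ h => neg_injective h
  have hinjW : Set.InjOn (fun k : ℤ => -k) W := fun a _ b _ h => neg_injective h
  have hinner : ∀ k ∈ W, ∑ l ∈ S, c l * fourierCoeff g₀ (k - l) = ∑ l' ∈ S', c' l' * fourierCoeff g' ((-k) - l') := by
    intro k hk
    rw [hS', Finset.sum_image hinjS]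
    refine Finset.sum_congr rfl fun l hl => ?_
    simp only [hc', neg_neg]
    rw [hcoef k hk l hl]
  have hLHS : ∑ k ∈ W, ‖∑ l ∈ S, c l * fourierCoeff g₀ (k - l)‖ ^ 2 =
      ∑ k' ∈ W', ‖∑ l' ∈ S', c' l' * fourierCoeff g' (k' - l')‖ ^ 2 := by
    rw [hW', Finset.sum_image hinjW]
    exact Finset.sum_congr rfl fun k hk => by rw [hinner k hk]
  rw [hLHS]
  -- hypotheses for the reflected data
  have hS'' : ∀ l ∈ S', |l| ≤ L := by
    intro l hl
    obtain ⟨l₀, hl₀, rfl⟩ := Finset.mem_image.mp hl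
    rw [abs_neg]; exact hS l₀ hl₀
  have hW'' : ∀ k ∈ W', |k| + L + D ≤ (L₂ : ℤ) := by
    intro k hk
    obtain ⟨k₀, hk₀, rfl⟩ := Finset.mem_image.mp hk
    rw [abs_neg]; exact hW k₀ hk₀
  -- reflected residue classes: `W'.filter (N ∣ k − ρ) = image of W.filter (N ∣ k − (−ρ))`
  have hWfil : ∀ ρ : ℤ, W'.filter (fun k => (N : ℤ) ∣ k - ρ) = (W.filter fun k => (N : ℤ) ∣ k - (-ρ)).image (fun k => -k) := by
    intro ρ
    ext k
    simp only [hW', Finset.mem_filter, Finset.mem_image]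
    constructor
    · rintro ⟨⟨k₀, hk₀, rfl⟩, hd⟩
      exact ⟨k₀, ⟨hk₀, by rw [show k₀ - -ρ = -(-k₀ - ρ) by ring]; exact (dvd_neg).mpr hd⟩, rfl⟩
    · rintro ⟨k₀, ⟨hk₀, hd⟩, rfl⟩
      exact ⟨⟨k₀, hk₀, rfl⟩, by rw [show -k₀ - ρ = -(k₀ - -ρ) by ring]; exact (dvd_neg).mpr hd⟩
  have hτ'' : ∀ i ∈ Finset.range p, ∀ ρ : ℤ,
      ∑ k ∈ W'.filter (fun k => (N : ℤ) ∣ k - ρ),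
        (∑ i' ∈ Finset.range p, Λ ^ i' * (1 / ((L₂ : ℝ) + k) ^ (i' + 1) + 1 / ((L₂ : ℝ) - k) ^ (i' + 1))) *
          (1 / ((L₂ : ℝ) + k) ^ (i + 1) + 1 / ((L₂ : ℝ) - k) ^ (i + 1)) * Λ ^ i ≤ τ i := by
    intro i hi ρ
    rw [hWfil ρ, Finset.sum_image (fun a _ b _ h => neg_injective h)]
    refine le_of_eq_of_le (Finset.sum_congr rfl fun k _ => ?_) (hτ i hi (-ρ))
    push_cast
    have e1 : ∀ m : ℕ, 1 / ((L₂ : ℝ) + -(k : ℝ)) ^ m + 1 / ((L₂ : ℝ) - -(k : ℝ)) ^ m =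
        1 / ((L₂ : ℝ) + k) ^ m + 1 / ((L₂ : ℝ) - k) ^ m := fun m => by
      rw [← sub_eq_add_neg, sub_neg_eq_add, add_comm]
    rw [e1]
    congr 1; congr 1
    exact Finset.sum_congr rfl fun i' _ => by rw [e1]
  have hσ'' : ∀ ρ : ℤ, ∑ k ∈ W'.filter (fun k => (N : ℤ) ∣ k - ρ),
      ((1 / ((L₂ : ℝ) + k) ^ p + 1 / ((L₂ : ℝ) - k) ^ p) / D) ^ 2 ≤ σξ := by
    intro ρ
    rw [hWfil ρ, Finset.sum_image (fun a _ b _ h => neg_injective h)]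
    refine le_of_eq_of_le (Finset.sum_congr rfl fun k _ => ?_) (hσ (-ρ))
    push_cast
    rw [← sub_eq_add_neg, sub_neg_eq_add, add_comm]
  have hMp'' : ∀ k : ℤ, ∑ l ∈ S'.filter (fun l => (N : ℤ) ∣ k - l), |(l : ℝ)| ^ (2 * p) ≤ Mp := by
    intro k
    have hset : S'.filter (fun l => (N : ℤ) ∣ k - l) = (S.filter fun l => (N : ℤ) ∣ (-k) - l).image (fun l => -l) := by
      ext l
      simp only [hS', Finset.mem_filter, Finset.mem_image]
      constructor
      · rintro ⟨⟨l₀, hl₀, rfl⟩, hd⟩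
        exact ⟨l₀, ⟨hl₀, by rw [show -k - l₀ = -(k - -l₀) by ring]; exact (dvd_neg).mpr hd⟩, rfl⟩
      · rintro ⟨l₀, ⟨hl₀, hd⟩, rfl⟩
        exact ⟨⟨l₀, hl₀, rfl⟩, by rw [show k - -l₀ = -(-k - l₀) by ring]; exact (dvd_neg).mpr hd⟩
    rw [hset, Finset.sum_image (fun a _ b _ h => neg_injective h)]
    refine le_of_eq_of_le (Finset.sum_congr rfl fun l _ => ?_) (hMp (-k))
    push_cast; rw [abs_neg]
  have hmain := cornerTraceGeom_sum_sq_le hN hg' c' S' hD hS'' W' hW'' p hΛ hε hτ'' hσ'' hMp''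
  -- identify the right-hand sides
  have hT : ∀ (i : ℕ) (y : ℝ), ∑ l ∈ S', c' l * (l : ℂ) ^ i * Complex.exp (2 * π * I * l * y) =
      (-1) ^ i * ∑ l ∈ S, c l * (l : ℂ) ^ i * Complex.exp (2 * π * I * l * ((-y : ℝ) : ℂ)) := by
    intro i y
    rw [hS', Finset.sum_image hinjS, Finset.mul_sum]
    refine Finset.sum_congr rfl fun l _ => ?_
    simp only [hc', neg_neg]
    push_cast
    rw [neg_pow]
    have e : Complex.exp (2 * π * I * -(l : ℂ) * y) = Complex.exp (2 * π * I * l * -(y : ℂ)) := by congr 1; ring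
    rw [e]; ring
  have hnormT : ∀ (i : ℕ) (y : ℝ), ‖∑ l ∈ S', c' l * (l : ℂ) ^ i * Complex.exp (2 * π * I * l * y)‖ =
      ‖∑ l ∈ S, c l * (l : ℂ) ^ i * Complex.exp (2 * π * I * l * ((-y : ℝ) : ℂ))‖ := by
    intro i y
    rw [hT, norm_mul, norm_pow, norm_neg, norm_one, one_pow, one_mul]
  have hc2 : ∑ l ∈ S', ‖c' l‖ ^ 2 = ∑ l ∈ S, ‖c l‖ ^ 2 := by
    rw [hS', Finset.sum_image hinjS]
    simp only [hc', neg_neg]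
  have hT1 : ∀ (i : ℕ) (r : ℕ), ‖∑ l ∈ S', c' l * (l : ℂ) ^ i * Complex.exp (2 * π * I * l * ((4 * (r : ℝ) - 1) / (4 * N)))‖ =
      ‖∑ l ∈ S, c l * (l : ℂ) ^ i * Complex.exp (2 * π * I * l * (-((4 * (r : ℝ) - 1) / (4 * N))))‖ := by
    intro i r
    have h := hnormT i ((4 * (r : ℝ) - 1) / (4 * N))
    push_cast at h ⊢
    exact h
  have hT2 : ∀ (i : ℕ) (r : ℕ), ‖∑ l ∈ S', c' l * (l : ℂ) ^ i * Complex.exp (2 * π * I * l * ((4 * (r : ℝ) + 1) / (4 * N)))‖ =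
      ‖∑ l ∈ S, c l * (l : ℂ) ^ i * Complex.exp (2 * π * I * l * (-((4 * (r : ℝ) + 1) / (4 * N))))‖ := by
    intro i r
    have h := hnormT i ((4 * (r : ℝ) + 1) / (4 * N))
    push_cast at h ⊢
    exact h
  simp_rw [hT1, hT2, hc2] at hmain
  exact hmain

end Summit.AnomalousDissipation.AnomalousDissipation.Theorems.SawtoothPulseCascade.K1Window
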